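import Summits.BirchSwinnertonDyer.Rank1Residual.X11a.SelmerCompanionTateLineIndex
import HarnessLib

/-!
# Route (3e) SELMER COMPANION, XXXIV: lemma G1 — the comparison index at a Tate-line place is
# `≤ p` (class X11a = N7; cell `b2b-bsdres`, unit `b2b-bsdres-x11a`, gen 31)

HONEST FRAMING (run/shared/lean/b2b/bsd-rank1-residual/, verbatim in every file): the goal of the
cell is to DELETE the COMBINATION-SHAPED residual classes of the Birch–Swinnerton-Dyer formula for
ALL analytic-rank `≤ 1` elliptic curves over `ℚ` — "full BSD formula for every rank `≤ 1` curve in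
class `C`" assembled STRICTLY from published theorems — so that the rank-`≤ 1` remainder becomes
exactly the CONSTRUCTION-SHAPED classes, which are TYPED (missing-input `Prop`s), NOT attempted.
This is not "finishing BSD". CLASS-OWNERS.md: research routes; NO CLAIM BEYOND STATED CLASSES.
THEOREMS ONLY; nothing booked; no label moves. CONDITIONAL on Tate's local Euler characteristic
(`hEP`, Milne *ADT* I Thm. 2.8) and on the per-pair data named (Tate datum of `E` = A40; the
Kummer point).

## What this file proves

`relIndex_map_selmerLocalKer_le_of_tateLine` — **lemma G1** of the census of gen 31
(`HOME/b2b-bsdres-x11a/g31/SELMER-COMPANION-CENSUS-v9.md` §3 (B)): `E = W` with an equivariant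
Tate datum `Φ'` at a finite place `v ∤ p` over `ℚ` (`E(ℚ_v)` from `ℚ_v^*`; Silverman *ATAEC*
V.3.1/V.5.3 at a place of split multiplicative reduction), `A` any curve, `θ : E[p] ≃ A[p]`
`Γ_ℚ`-equivariant, the `p`-th roots of unity fixed by `Γ_{ℚ_v}` (`hμ`: `μ_p ⊂ ℚ_v`, the
full-torsion case `E(ℚ_v)[p] = E[p]`), and ONE Kummer point `h ∈ A(K̄_v)` along the transported
Tate line (`hpt`: `σh − h ∈ θΦ'(μ_p)` for all `σ`, `σ₁h ≠ h` for some `σ₁`; per pair: a `p`-th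
root of a point of `A(ℚ_v)` whose class points along `Λ̃`, a finite certificate). Then
**`[θ_* 𝓢_v(E) : θ_* 𝓢_v(E) ∩ 𝓢_v(A)] ≤ p`** — the census of gens 26–30 charged `#E(ℚ_v)[p] = p²`
at such places. Proof: `𝓢_v(A) = ker Λ_v` (file XIX); every class of `𝓢_v(E)` is locally
`σ ↦ Φ'(σw/w) + (σT₀ − T₀)` (file XXXI / kind (ii)), so `Λ_v(θ_* c)` is the class of the cocycle
`σ ↦ θΦ'(σw/w)` valued in the line `ℤ·θΦ'(ζ₀)`, and file XXXIII bounds the classes of such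
cocycles by `p` (if the line is `0` every transported class is Selmer for `A`, index `1`).
File XXXV assembles shape G. References: [MazurRubin2004] §2.3; [MilneADT2006] I Thm. 2.8;
[SilvermanATAEC1994] V.3.1, V.5.3, IV Rem. 9.6; files XIX, XXXI, XXXIII; HOME/b2b-bsdres-x11a/REPORT-g31.md.
-/

set_option autoImplicit false

noncomputable section

open scoped Classical NNReal

open WeierstrassCurve Literature.NumberTheory.EllipticCurves
  Literature.NumberTheory.GaloisRepresentations Field NumberField IsDedekindDomain
  IsDedekindDomain.HeightOneSpectrum

namespace Summit.BirchSwinnertonDyer.Rank1Residual.X11a.SelmerCompanion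

variable (W A : WeierstrassCurve ℚ) [W.IsElliptic] (p : ℕ) [hp : Fact p.Prime]

set_option maxHeartbeats 800000 in
-- heavy instances at `ℚ_v`; not a search
/-- **Lemma G1: the comparison index at a Tate-line place is `≤ p`.** `v ∤ p`; `Φ'` an equivariant
Tate datum of `E = W` at `v` with `E(ℚ_v)` from `ℚ_v^*`; `θ : E[p] ≃ A[p]`; `μ_p` fixed by `Γ_{ℚ_v}`
(`hμ`); a Kummer point `h` along the transported Tate line (`hpt`). Then
`[θ_* 𝓢_v(E) : θ_* 𝓢_v(E) ∩ 𝓢_v(A)] ≤ p`. Granted `hEP`. See the module docstring.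
[cite: MazurRubin2004, §2.3] [cite: MilneADT2006, Ch. I §2, Thm. 2.8]
[cite: SilvermanATAEC1994, Ch. V Thm. 3.1 (c),(d), Thm. 5.3] -/
theorem relIndex_map_selmerLocalKer_le_of_tateLine {v : HeightOneSpectrum (𝓞 ℚ)}
    (hEP : localEulerPoincareCharacteristic (v.adicCompletion ℚ)) (hpv : (p : 𝓞 ℚ) ∉ v.asIdeal)
    (hn : (p : ℤ) ≠ 0)
    (θ : geomTorsion W (p : ℤ) ≃+ geomTorsion A (p : ℤ))
    (hθ : ∀ (σ : absoluteGaloisGroup ℚ) (P : geomTorsion W (p : ℤ)), θ (σ • P) = σ • θ P)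
    (Φ' : Additive (AlgebraicClosure (v.adicCompletion ℚ))ˣ →+ localPoints W (v.adicCompletion ℚ))
    (hequiv' : ∀ (σ : absoluteGaloisGroup (v.adicCompletion ℚ))
        (u : (AlgebraicClosure (v.adicCompletion ℚ))ˣ),
      σ • Φ' (Additive.ofMul u) = Φ' (Additive.ofMul (Units.map
        (absoluteGaloisGroup.toAlgEquiv _ σ : AlgebraicClosure (v.adicCompletion ℚ) →*
          AlgebraicClosure (v.adicCompletion ℚ)) u)))
    (hrat' : ∀ P : localPoints W (v.adicCompletion ℚ),
      (∀ σ : absoluteGaloisGroup (v.adicCompletion ℚ), σ • P = P) →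
      ∃ u : (v.adicCompletion ℚ)ˣ, Φ' (Additive.ofMul (Units.map (algebraMap (v.adicCompletion ℚ)
        (AlgebraicClosure (v.adicCompletion ℚ)) : v.adicCompletion ℚ →*
          AlgebraicClosure (v.adicCompletion ℚ)) u)) = P)
    (hμ : ∀ (σ : absoluteGaloisGroup (v.adicCompletion ℚ))
        (ζ : (AlgebraicClosure (v.adicCompletion ℚ))ˣ), ζ ^ p = 1 →
      Units.map (absoluteGaloisGroup.toAlgEquiv _ σ : AlgebraicClosure (v.adicCompletion ℚ) →*
        AlgebraicClosure (v.adicCompletion ℚ)) ζ = ζ)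
    (hpt : ∃ h : localPoints A (v.adicCompletion ℚ),
      (∀ σ : absoluteGaloisGroup (v.adicCompletion ℚ),
        ∃ (ζ : (AlgebraicClosure (v.adicCompletion ℚ))ˣ) (_ : ζ ^ p = 1)
          (hζ : Φ' (Additive.ofMul ζ) ∈
            AddSubgroup.torsionBy (localPoints W (v.adicCompletion ℚ)) (p : ℤ)),
          σ • h - h = pointsMap A (v.adicCompletion ℚ)
            ((θ ((W.torsionPointsEquiv (p : ℤ) (E := v.adicCompletion ℚ) hn).symm
              ⟨Φ' (Additive.ofMul ζ), hζ⟩) : geomTorsion A (p : ℤ)) : geomPoints A)) ∧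
      ∃ σ₁ : absoluteGaloisGroup (v.adicCompletion ℚ), σ₁ • h ≠ h) :
    (selmerLocalKer A (v.adicCompletion ℚ) (p : ℤ)).relIndex
      ((selmerLocalKer W (v.adicCompletion ℚ) (p : ℤ)).map (h1Equiv θ hθ).toAddMonoidHom) ≤ p := by
  have hpp : p.Prime := hp.out
  haveI : NeZero p := ⟨hpp.ne_zero⟩
  -- NB: no `CharZero ℚ_v` instance (it would re-route `Algebra ℚ ℚ_v`); `NeZero` suffices
  haveI : NeZero ((p : ℕ) : v.adicCompletion ℚ) := ⟨by
    rw [← map_natCast (algebraMap ℚ (v.adicCompletion ℚ))]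
    exact (map_ne_zero _).mpr (Nat.cast_ne_zero.mpr hpp.ne_zero)⟩
  haveI : NeZero ((p : ℕ) : AlgebraicClosure (v.adicCompletion ℚ)) := ⟨by
    rw [← map_natCast (algebraMap (v.adicCompletion ℚ) (AlgebraicClosure (v.adicCompletion ℚ)))]
    exact (map_ne_zero _).mpr (NeZero.ne _)⟩
  -- a primitive root `Z`, the transport `G`, the point `L₀ = G(Φ'(Z))`
  obtain ⟨ζ₀, hζ₀⟩ := HasEnoughRootsOfUnity.exists_primitiveRoot (AlgebraicClosure
      (v.adicCompletion ℚ)) p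
  have hZu : IsUnit ζ₀ := hζ₀.isUnit hpp.ne_zero
  set Z : (AlgebraicClosure (v.adicCompletion ℚ))ˣ := hZu.unit with hZdef
  have hZ : IsPrimitiveRoot (Z : (AlgebraicClosure (v.adicCompletion ℚ))) p := by
    rw [hZdef, IsUnit.unit_spec]; exact hζ₀
  have hZp : Z ^ p = 1 :=
    Units.ext (by rw [Units.val_pow_eq_pow_val, hZ.pow_eq_one, Units.val_one])
  set e' := W.torsionPointsEquiv (p : ℤ) (E := (v.adicCompletion ℚ)) hn with he'
  set G : AddSubgroup.torsionBy (localPoints W (v.adicCompletion ℚ)) (p : ℤ) →+ localPoints A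
      (v.adicCompletion ℚ) :=
    ((pointsMap A (v.adicCompletion ℚ)).comp (geomTorsion A (p : ℤ)).subtype).comp
      (θ.toAddMonoidHom.comp e'.symm.toAddMonoidHom) with hG
  have hG_apply : ∀ T, G T = pointsMap A (v.adicCompletion ℚ) ((θ (e'.symm T) : geomTorsion A
      (p : ℤ)) : geomPoints A) := fun T ↦ rfl
  have hGsmul : ∀ (σ : (absoluteGaloisGroup (v.adicCompletion ℚ))) (T : AddSubgroup.torsionBy
      (localPoints W (v.adicCompletion ℚ)) (p : ℤ)),
      G (σ • T) = σ • G T := by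
    intro σ T
    rw [hG_apply, hG_apply, he', torsionPointsEquiv_symm_smul, hθ,
      Literature.NumberTheory.EllipticCurves.AddSubgroup.torsionBy.coe_smul, pointsMap_smul]
  have hmem' : ∀ {ζ : (AlgebraicClosure (v.adicCompletion ℚ))ˣ}, ζ ^ p = 1 →
      Φ' (Additive.ofMul ζ) ∈ AddSubgroup.torsionBy (localPoints W (v.adicCompletion ℚ)) (p : ℤ) :=
    fun hζ ↦ (Submodule.mem_torsionBy_iff _ _).mpr
        (W.zsmul_map_ofMul_eq_zero_of_pow_eq_one v Φ' hζ)
  set XZ : AddSubgroup.torsionBy (localPoints W (v.adicCompletion ℚ)) (p : ℤ) := ⟨Φ'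
      (Additive.ofMul Z), hmem' hZp⟩ with hXZ
  set L₀ : localPoints A (v.adicCompletion ℚ) := G XZ with hL₀
  have hL₀p : (p : ℤ) • L₀ = 0 := by
    have h0 : (p : ℤ) • XZ = 0 := Subtype.ext (by
      rw [AddSubgroupClass.coe_zsmul, hXZ, AddSubgroup.coe_zero]
      exact W.zsmul_map_ofMul_eq_zero_of_pow_eq_one v Φ' hZp)
    rw [hL₀, ← map_zsmul, h0, map_zero]
  have hL₀fix : ∀ σ : absoluteGaloisGroup (v.adicCompletion ℚ), σ • L₀ = L₀ := by
    intro σ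
    have h1 : σ • XZ = XZ := Subtype.ext (by
      rw [Literature.NumberTheory.EllipticCurves.AddSubgroup.torsionBy.coe_smul, hXZ]
      change σ • Φ' (Additive.ofMul Z) = Φ' (Additive.ofMul Z)
      rw [hequiv', hμ σ Z hZp])
    rw [hL₀, ← hGsmul, h1]
  -- every `G(Φ'(ζ))`, `ζ^p = 1`, is a multiple of `L₀`
  have hclaim : ∀ (ζ : (AlgebraicClosure (v.adicCompletion ℚ))ˣ) (hζ : ζ ^ p = 1)
      (hζ' : Φ' (Additive.ofMul ζ) ∈
        AddSubgroup.torsionBy (localPoints W (v.adicCompletion ℚ)) (p : ℤ)),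
      G ⟨Φ' (Additive.ofMul ζ), hζ'⟩ ∈ AddSubgroup.zmultiples L₀ := by
    intro ζ hζ hζ'
    obtain ⟨k, -, hk⟩ := hZ.eq_pow_of_pow_eq_one (ξ := (ζ : (AlgebraicClosure
        (v.adicCompletion ℚ))))
      (by rw [← Units.val_pow_eq_pow_val, hζ, Units.val_one])
    have hζk : ζ = Z ^ k := Units.ext (by rw [← hk, Units.val_pow_eq_pow_val])
    have hX : (⟨Φ' (Additive.ofMul ζ), hζ'⟩ : AddSubgroup.torsionBy (localPoints W
        (v.adicCompletion ℚ)) (p : ℤ)) = k • XZ := Subtype.ext (by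
      rw [AddSubgroupClass.coe_nsmul, hXZ]
      change Φ' (Additive.ofMul ζ) = k • Φ' (Additive.ofMul Z)
      rw [hζk, ofMul_pow, map_nsmul])
    rw [hX, map_nsmul]
    exact AddSubgroup.nsmul_mem_zmultiples L₀ k
  -- the local condition of `A` as a kernel
  obtain ⟨Λ, hΛker, hΛapp⟩ := selmerLocalKer_eq_ker_and_apply A (v.adicCompletion ℚ) (p : ℤ)
  -- every class of `θ_* 𝓢_v(E)` maps under `Λ` to the class of a `ℤ·L₀`-valued cocycle
  have hclass : ∀ c ∈ selmerLocalKer W (v.adicCompletion ℚ) (p : ℤ),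
      ∃ φf : contOneCocycles (discreteTopRep (absoluteGaloisGroup (v.adicCompletion ℚ))
          (localPoints A (v.adicCompletion ℚ))),
        Λ (h1Equiv θ hθ c) = oneCocycleClass _ φf ∧
        ∀ σ, φf.1 σ ∈ AddSubgroup.zmultiples L₀ := by
    intro c hc
    obtain ⟨φ, rfl⟩ :=
      oneCocycleClass_surjective (discreteTopRep (absoluteGaloisGroup ℚ) (geomTorsion W (p : ℤ))) c
    have hc' := hc
    rw [selmerLocalKer, oneCocycleClass_mem_resKer_iff] at hc'
    obtain ⟨a', ha'⟩ := hc'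
    have ha'' : ∀ σ : (absoluteGaloisGroup (v.adicCompletion ℚ)), pointsMap W (v.adicCompletion ℚ)
        ((φ.1 (resGal (K := ℚ) (v.adicCompletion ℚ) σ) : geomTorsion W (p : ℤ)) :
        geomPoints W) = σ • a' - a' := fun σ ↦ ha' σ
    have hP'fix : ∀ σ : (absoluteGaloisGroup (v.adicCompletion ℚ)), σ • ((p : ℤ) • a') =
        (p : ℤ) • a' := by
      intro σ
      have h0 : (p : ℤ) • (σ • a' - a') = 0 := by
        rw [← ha'' σ, ← map_zsmul, (mem_geomTorsion_iff W _ _).mp (φ.1 _).2, map_zero]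
      rw [W.smul_zsmul_localPoints (p : ℤ) σ a']
      rw [zsmul_sub, sub_eq_zero] at h0
      exact h0
    obtain ⟨u, hu⟩ := hrat' ((p : ℤ) • a') hP'fix
    set uu : (AlgebraicClosure (v.adicCompletion ℚ))ˣ := Units.map (algebraMap (v.adicCompletion ℚ)
        (AlgebraicClosure (v.adicCompletion ℚ)) : (v.adicCompletion ℚ) →* (AlgebraicClosure
        (v.adicCompletion ℚ))) u with huu
    have huu0 : (uu : (AlgebraicClosure (v.adicCompletion ℚ))) ≠ 0 := uu.ne_zero
    obtain ⟨z, hz⟩ := IsAlgClosed.exists_pow_nat_eq (uu : (AlgebraicClosure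
        (v.adicCompletion ℚ))) hpp.pos
    have hz0 : z ≠ 0 := by
      rintro rfl
      rw [zero_pow hpp.ne_zero] at hz
      exact huu0 hz.symm
    set w : (AlgebraicClosure (v.adicCompletion ℚ))ˣ := Units.mk0 z hz0 with hw
    have hwp : w ^ p = uu := Units.ext (by rw [Units.val_pow_eq_pow_val, hw, Units.val_mk0, hz])
    set R' : localPoints W (v.adicCompletion ℚ) := Φ' (Additive.ofMul w) with hR'
    have hR'p : (p : ℤ) • R' = (p : ℤ) • a' := by
      rw [hR', ← map_zsmul, ← ofMul_zpow, zpow_natCast, hwp, huu, hu]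
    set T : localPoints W (v.adicCompletion ℚ) := a' - R' with hT
    have hTp : (p : ℤ) • T = 0 := by rw [hT, zsmul_sub, hR'p, sub_self]
    set Tt : AddSubgroup.torsionBy (localPoints W (v.adicCompletion ℚ)) (p : ℤ) :=
      ⟨T, (Submodule.mem_torsionBy_iff _ _).mpr hTp⟩ with hTt
    set T₀ : geomTorsion W (p : ℤ) := e'.symm Tt with hT₀
    have hT₀' : pointsMap W (v.adicCompletion ℚ) (T₀ : geomPoints W) = T := by
      rw [hT₀, he', W.pointsMap_torsionPointsEquiv_symm (p : ℤ) hn Tt]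
    have hσuu : ∀ σ : (absoluteGaloisGroup (v.adicCompletion ℚ)),
        (absoluteGaloisGroup.toAlgEquiv _ σ : AlgebraicClosure (v.adicCompletion ℚ) →*
          AlgebraicClosure (v.adicCompletion ℚ)) (uu : (AlgebraicClosure (v.adicCompletion ℚ)))
          = uu := by
      intro σ
      rw [huu, Units.coe_map, MonoidHom.coe_coe, MonoidHom.coe_coe, AlgEquiv.commutes]
    have hζσ : ∀ σ : (absoluteGaloisGroup (v.adicCompletion ℚ)), (Units.map
        (absoluteGaloisGroup.toAlgEquiv _ σ : AlgebraicClosure (v.adicCompletion ℚ)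
        →* AlgebraicClosure (v.adicCompletion ℚ)) w / w) ^ p = 1 := by
      intro σ
      apply Units.ext
      rw [Units.val_pow_eq_pow_val, Units.val_div_eq_div_val, div_pow, Units.coe_map, ← map_pow,
        ← Units.val_pow_eq_pow_val, hwp, hσuu, div_self huu0, Units.val_one]
    have hφσ : ∀ σ : (absoluteGaloisGroup (v.adicCompletion ℚ)), φ.1 (resGal (K := ℚ)
        (v.adicCompletion ℚ) σ) =
        e'.symm ⟨Φ' (Additive.ofMul (Units.map
            (absoluteGaloisGroup.toAlgEquiv _ σ : AlgebraicClosure (v.adicCompletion ℚ)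
            →* AlgebraicClosure (v.adicCompletion ℚ)) w / w)), hmem' (hζσ σ)⟩ +
          (resGal (K := ℚ) (v.adicCompletion ℚ) σ • T₀ - T₀) := by
      intro σ
      apply Subtype.ext
      apply pointsMapOfEmb_injective W (closureEmb (K := ℚ) (v.adicCompletion ℚ))
      change pointsMap W (v.adicCompletion ℚ) _ = pointsMap W (v.adicCompletion ℚ) _
      rw [ha'' σ, AddSubgroup.coe_add, AddSubgroup.coe_sub, map_add, map_sub,
        Literature.NumberTheory.EllipticCurves.AddSubgroup.torsionBy.coe_smul, pointsMap_smul, hT₀',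
        he', W.pointsMap_torsionPointsEquiv_symm (p : ℤ) hn]
      change σ • a' - a' = Φ' (Additive.ofMul (Units.map
          (absoluteGaloisGroup.toAlgEquiv _ σ : AlgebraicClosure (v.adicCompletion ℚ)
          →* AlgebraicClosure (v.adicCompletion ℚ)) w / w)) + (σ • T - T)
      rw [ofMul_div, map_sub, ← hequiv' σ w, ← hR', hT, smul_sub]
      abel
    -- the image cocycle `ψ'` of `Λ`, the slack `t = θ T₀`, and the line-valued cocycle `φf = ψ' - ∂t`
    obtain ⟨ψ', hψ'eq, hψ'app⟩ := hΛapp (contOneCocycles.pullback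
      (ContinuousMonoidHom.id (absoluteGaloisGroup ℚ))
      (resHomOfEquivariant (ContinuousMonoidHom.id (absoluteGaloisGroup ℚ))
        (θ : geomTorsion W (p : ℤ) →+ geomTorsion A (p : ℤ)) hθ) φ)
    set t : localPoints A (v.adicCompletion ℚ) :=
      pointsMap A (v.adicCompletion ℚ) ((θ T₀ : geomTorsion A (p : ℤ)) : geomPoints A) with htdef
    have hψ't : ∀ σ : absoluteGaloisGroup (v.adicCompletion ℚ), ψ'.1 σ - (σ • t - t) =
        G ⟨Φ' (Additive.ofMul (Units.map
            (absoluteGaloisGroup.toAlgEquiv _ σ : AlgebraicClosure (v.adicCompletion ℚ)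
            →* AlgebraicClosure (v.adicCompletion ℚ)) w / w)), hmem' (hζσ σ)⟩ := by
      intro σ
      rw [hψ'app, h1Equiv_oneCocycleClass_apply, hφσ σ, map_add, map_sub, AddSubgroup.coe_add,
        AddSubgroup.coe_sub, map_add, map_sub, ← hG_apply, hθ,
        Literature.NumberTheory.EllipticCurves.AddSubgroup.torsionBy.coe_smul, pointsMap_smul,
        ← htdef]
      abel
    set f : absoluteGaloisGroup (v.adicCompletion ℚ) → localPoints A (v.adicCompletion ℚ) :=
      fun σ ↦ ψ'.1 σ - (σ • t - t) with hfdef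
    have hfc : Continuous f :=
      ψ'.1.continuous.sub ((continuous_smul_localPoints A (v.adicCompletion ℚ) t).sub
        continuous_const)
    have hψ'1 : ∀ σ τ, ψ'.1 (σ * τ) = ψ'.1 σ + σ • ψ'.1 τ := fun σ τ ↦ by
      have hh := ψ'.2 σ τ
      rwa [discreteTopRep_ρ_apply] at hh
    have hf1 : ∀ σ τ, f (σ * τ) = f σ + σ • f τ := by
      intro σ τ
      simp only [hfdef]
      rw [hψ'1, mul_smul, smul_sub, smul_sub]
      abel
    let φf : contOneCocycles (discreteTopRep (absoluteGaloisGroup (v.adicCompletion ℚ))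
        (localPoints A (v.adicCompletion ℚ))) :=
      ⟨⟨f, hfc⟩, fun σ τ ↦ by
        change f (σ * τ) = f σ + σ • f τ
        exact hf1 σ τ⟩
    have hφf : ∀ σ, φf.1 σ = f σ := fun σ ↦ rfl
    refine ⟨φf, ?_, fun σ ↦ ?_⟩
    · rw [h1Equiv_oneCocycleClass, hψ'eq, ← sub_eq_zero, ← oneCocycleClass_sub,
        oneCocycleClass_eq_zero_iff]
      refine ⟨t, fun σ ↦ ?_⟩
      rw [discreteTopRep_ρ_apply]
      change ψ'.1 σ - φf.1 σ = σ • t - t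
      rw [hφf]
      change ψ'.1 σ - (ψ'.1 σ - (σ • t - t)) = σ • t - t
      rw [sub_sub_cancel]
    · rw [hφf]
      change ψ'.1 σ - (σ • t - t) ∈ _
      rw [hψ't σ]
      exact hclaim _ (hζσ σ) _
  -- the index is the size of the image of `Λ` on `θ_* 𝓢_v(E)`
  by_cases hL₀0 : L₀ = 0
  · -- degenerate case: the line is `0`, every transported class is Selmer for `A` (index `1`)
    have hle : (selmerLocalKer W (v.adicCompletion ℚ) (p : ℤ)).map (h1Equiv θ hθ).toAddMonoidHom ≤
        selmerLocalKer A (v.adicCompletion ℚ) (p : ℤ) := by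
      rintro x hx
      obtain ⟨c, hc, rfl⟩ := AddSubgroup.mem_map.mp hx
      obtain ⟨φf, hΛc, hval⟩ := hclass c hc
      change h1Equiv θ hθ c ∈ selmerLocalKer A (v.adicCompletion ℚ) (p : ℤ)
      rw [hΛker, AddMonoidHom.mem_ker, hΛc, oneCocycleClass_eq_zero_iff]
      refine ⟨0, fun σ ↦ ?_⟩
      have h0 : φf.1 σ = 0 := by
        have hm := hval σ
        rw [hL₀0, AddSubgroup.zmultiples_zero_eq_bot, AddSubgroup.mem_bot] at hm
        exact hm
      rw [h0, discreteTopRep_ρ_apply, smul_zero, sub_zero]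
    rw [AddSubgroup.relIndex_eq_one.mpr hle]
    exact hpp.one_lt.le
  · rw [hΛker, AddSubgroup.relIndex_ker]
    -- the Kummer point along the line, in `ℤ·L₀` form
    have hpt' : ∃ h : localPoints A (v.adicCompletion ℚ),
        (∀ σ : absoluteGaloisGroup (v.adicCompletion ℚ), σ • h - h ∈ AddSubgroup.zmultiples L₀) ∧
        ∃ σ₁ : absoluteGaloisGroup (v.adicCompletion ℚ), σ₁ • h ≠ h := by
      obtain ⟨h, hh, σ₁, hσ₁⟩ := hpt
      refine ⟨h, fun σ ↦ ?_, σ₁, hσ₁⟩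
      obtain ⟨ζ, hζ, hζ', hσh⟩ := hh σ
      rw [hσh, ← hG_apply]
      exact hclaim ζ hζ hζ'
    obtain ⟨S, hSfin, hScard, hS⟩ :=
      OrdinaryLine.exists_small_set_of_lineValued_classes hEP hpv A hL₀p hL₀0 hL₀fix hpt'
    refine le_trans (Nat.card_mono hSfin ?_) hScard
    rintro x hx
    obtain ⟨d, hd, rfl⟩ := AddSubgroup.mem_map.mp hx
    obtain ⟨c, hc, rfl⟩ := AddSubgroup.mem_map.mp hd
    obtain ⟨φf, hΛc, hval⟩ := hclass c hc
    change Λ (h1Equiv θ hθ c) ∈ S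
    rw [hΛc]
    exact hS φf hval

end Summit.BirchSwinnertonDyer.Rank1Residual.X11a.SelmerCompanion

end
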